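import Summits.BirchSwinnertonDyer.BirchSwinnertonDyer.Theorems.KatoDescentTamePotSupersingularJetchevIrreducibleSwapLevelRaising
import Summits.BirchSwinnertonDyer.BirchSwinnertonDyer.Theorems.KatoDescentTamePotSupersingularJetchevIrreducibleProp47Adapter2
import Summits.BirchSwinnertonDyer.BirchSwinnertonDyer.Theorems.ClassRecordThreeEulerHalvesAtThreeWalkSupplyDisjoint
import Summits.BirchSwinnertonDyer.BirchSwinnertonDyer.Theorems.ClassRecordThreeEulerHalvesAtThreeWalkSupplyDuality
import Summits.BirchSwinnertonDyer.BirchSwinnertonDyer.Theorems.Rank1ResidualJetKolyvaginLocalTerm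
import Summits.BirchSwinnertonDyer.BirchSwinnertonDyer.Theorems.Rank1ResidualJetWeilDatum
import Summits.BirchSwinnertonDyer.Rank1Residual.JET.RingClassTransverseLagrangian
import Summits.BirchSwinnertonDyer.Rank1Residual.JET.TransverseFamilyConjAct
import HarnessLib

/-!
# Crux `JetchevIrreducibleReadingByName` (item 20165, shared K8-t′ / K9, cell `bsd-potss`), registered stub S2′
# `stub_prop52IrredP` (McCallum 1991 Prop. 5.2, IRREDUCIBLE reading): «LEVEL RAISING AT MINIMAL DEPTH» — the only use
# the §6 bridge makes of Prop. 5.2 — is a KERNEL THEOREM on an irreducible row MODULO NAMED PRINT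
# {McCallum Prop. 4.4 (B) primed `ℓ ≠ 2` (`h47P2`, itself ⟸ Gross 1991 Prop. 3.7 (2)), Poitou–Tate, [GZ86 III (3.1)] scoped}

Seat `bsd-potss-k8t-c4` g12 (prover), `--supports stmt-BirchSwinnertonDyer-20165`, helper; route-free. HONEST
FRAMING: helper theorems only; nothing is booked, no item closes, BSD is proved for no curve by any of this.

WHAT. `…SwapLevelRaising` (this seat) assembled Kolyvagin's prime-swap walk on an irreducible row modulo the level-`p`
structures (Poitou–Tate package, Weil datum, global transverse family with its four local inputs), the row binder
`h47row` and [GZ86 III (3.1)] scoped. Here those structures are SUPPLIED exactly as cell `bsd-jet` pv-1 g8 supplied them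
for the core-vertex walk (`Rank1ResidualJetCoreVertexExistenceOfNamedPrint`, `case hPT/hdisj`): `inv` from the named
fact `poitouTate_selmerStructure_duality_conj K`; the Weil datum by `JET.exists_weilDatum_liftAut` (PROVED); the family
by `Walk.exists_globalTransverseFamily` with `h𝒯σ` (`Walk.globalTransverse_conjActPlace_mem` ∘
`JET.forall_conjActPlace_mem_of_eq_iInf_transverseSubgroup`, lit-ty), `h𝒯sd` (`Walk.globalTransverse_dualTransported_eq` ∘
`JET.RingClassTransverse.dualTransported_eq_of_localTransverseFamily`, guarded `d_K < −4`), `hloc`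
(`JET.GlobalDuality.relIndex_kummer_ker_conjActPlace_eq_pow`, pv-1 g6) and `hdisj`
(`Walk.globalTransverse_disjoint_kummer` ∘ `Walk.disjoint_kummer_iInf_transverseSubgroup`); `τ² = 1` by
`Walk.algEquiv_mul_self_eq_one`. RESULTS:
* `levelRaising_of_h47row_of_poitouTate_of_GZ31_of_irreducible` — at one frame: pv-2's binder `hraise` VERBATIM from
  {`h47row` (guard `G` at every Kolyvagin prime), `poitouTate_selmerStructure_duality_conj K`, [GZ86 III (3.1)] scoped
  with `n'` prime to `p`};
* `levelRaising_of_prop47P2_of_poitouTate_of_GZ31g` — the closed form: for every frame of 20165's node with `p ≠ 3`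
  (so that no Zhang–Kolyvagin prime is `2`, the guard of `h47P2`; automatic on the K8-t′ face `p ≥ 5`), `hraise` ⟸
  {`h47P2` (k8t-c4 g11: ⟸ `GrossLMS1991.prop37_2_frobeniusCongruence`, p541604), `hPT` (∀ K), `hGZg` (k9-c4 g10's guarded
  image-free receptacle schema ⟸ `Gross1991_heegnerPoint_sub_ratTorsion_mem_E0_imageFree`)}.
So on the K8-t′ face the S2′-input of the node `Sig.S2DivisibilityIrredAddv` (pv-2's image-free bridge
`JET.derivedPoint_divisible_of_levelRaising_of_section6_min` consumes exactly `hraise`) rests on NAMED PRINT ONLY.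

References (locators only; no cited FACT is declared): [cite: McCallumLMS1991, §5 Prop. 5.2 and proof (pp. 304–306),
§4 Prop. 4.4] [cite: Jetchev2008, proof of Thm. 1.4 (p. 824), Lemma 5.1–5.2, Rem. 6.2] [cite: GrossLMS1991, Prop. 3.7 (2),
Prop. 6.2 (1)] [cite: GrossZagier1986, III (3.1)] [cite: MilneADT2006, Ch. I, Thm. 4.10] [cite: Howard2004HeegnerKolyvagin,
Prop. 2.1.9 (ii), Thm. 2.1.11]. Design: theorems only; `K : Type`. Axioms: `propext`, `Classical.choice`, `Quot.sound`.
-/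

set_option autoImplicit false
-- the Theorems directory repeats the summit name (sibling precedent `KatoDescentPotSupersingularAssembly.lean`)
set_option linter.dupNamespace false

noncomputable section
open scoped Classical Pointwise
open Function NumberField IsDedekindDomain WeierstrassCurve Field
open Literature.NumberTheory.EllipticCurves Literature.NumberTheory.GaloisRepresentations
open Literature.NumberTheory.EllipticCurves.Jetchev2008 Literature.NumberTheory.EllipticCurves.KolyvaginCocycle
open Literature.NumberTheory.EllipticCurves.ModularForms
open Literature.NumberTheory.GaloisCohomology Literature.NumberTheory.Automorphic
open Literature.NumberTheory.GaloisRepresentations.DiscreteGaloisModule (transverseSubgroup SelmerStructure)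
open Summit.BirchSwinnertonDyer.Rank1Residual
open Summit.BirchSwinnertonDyer.Rank1Residual.JET
open Summit.BirchSwinnertonDyer.Rank1Residual.JET.SelmerVocabulary
open Summit.BirchSwinnertonDyer.Rank1Residual.JET.GlobalDuality
open Summit.BirchSwinnertonDyer.Rank1Residual.X11b
open Summit.BirchSwinnertonDyer.Rank1Residual.X11b.Three
open Summit.BirchSwinnertonDyer.BirchSwinnertonDyer.Theorems

namespace Summit.BirchSwinnertonDyer.BirchSwinnertonDyer.Theorems.JetchevIrreducibleSwap

variable {K : Type} [Field K] [NumberField K] (W : WeierstrassCurve ℚ) [W.IsElliptic]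
  [W.IsGloballyMinimal] [NeZero (W.conductorNorm ℤ)]

/-- **Level raising at minimal depth on an IRREDUCIBLE row from the row binder `h47row`, Poitou–Tate and [GZ86 III (3.1)]
scoped** — the conclusion is cell `bsd-jet` pv-2's binder `hraise` (of `JET.derivedPoint_divisible_of_levelRaising_of_section6_min`)
VERBATIM at the frame `(W, K, p, Dt, β, ι)`. The level-`p` structures of `exists_conductor_levelIndex_ge_of_minDepth_of_irreducible`
are supplied from the named fact `poitouTate_selmerStructure_duality_conj K`, the proved Weil datum, and the global transverse
family with its four local inputs (module docstring). [cite: McCallumLMS1991, §5 Prop. 5.2 and proof (pp. 304–306)]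
[cite: Jetchev2008, proof of Thm. 1.4 (p. 824), Lemma 5.2] [cite: MilneADT2006, Ch. I, Thm. 4.10] -/
theorem levelRaising_of_h47row_of_poitouTate_of_GZ31_of_irreducible (hK : IsImaginaryQuadratic K)
    (hD3 : NumberField.discr K ≠ -3) (hD4 : NumberField.discr K ≠ -4)
    (hH : SatisfiesHeegnerHypothesis (W.conductorNorm ℤ) K) (hcm : ¬ W.HasCM)
    (τ : K ≃ₐ[ℚ] K) (hτ1 : τ ≠ 1) (p : ℕ) [Fact p.Prime] (hp2 : p ≠ 2)
    (hirr : W.HasIrreducibleModPGaloisRep p) (hpN : p ∣ W.conductorNorm ℤ)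
    (Dt : ModularParametrizationData W (W.conductorNorm ℤ)) (β : ℤ) (ι : K →+* ℂ)
    [∀ j : ℕ, NumberField (ringClassField K ι j)]
    (G : ℕ → Prop) (hG : ∀ ℓ : ℕ, Zhang2014.IsKolyvaginPrime (W.conductorNorm ℤ) W K p ℓ → G ℓ)
    (h47row : ∀ (M : ℕ), 1 ≤ M → ∀ (m l : ℕ), Squarefree (m * l) → l.Prime → G l → ¬ l ∣ m →
      (∀ l' ∈ (m * l).primeFactors, Zhang2014.IsKolyvaginPrime (W.conductorNorm ℤ) W K p l' ∧
        M ≤ Zhang2014.kolyvaginIndex W p l') →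
      ∀ (d : KolyvaginHeegnerData Dt β ι m) (d' : KolyvaginHeegnerData Dt β ι (m * l)),
      (∀ l' ∈ m.primeFactors, ∀ (x : ringClassField K ι m) (x' : ringClassField K ι (m * l)),
        (x : ℂ) = x' → ((d'.σ l' x' : ringClassField K ι (m * l)) : ℂ) = (d.σ l' x : ℂ)) →
      (∀ s ∈ d.S, ∃ s' ∈ d'.S, ∀ (x : ringClassField K ι m) (x' : ringClassField K ι (m * l)),
        (x : ℂ) = x' → ((s' x' : ringClassField K ι (m * l)) : ℂ) = (s x : ℂ)) →
      (∀ s' ∈ d'.S, ∃ s ∈ d.S, ∀ (x : ringClassField K ι m) (x' : ringClassField K ι (m * l)),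
        (x : ℂ) = x' → ((s' x' : ringClassField K ι (m * l)) : ℂ) = (s x : ℂ)) →
      (∀ (x : ringClassField K ι m) (x' : ringClassField K ι (m * l)),
        (x : ℂ) = x' → d'.emb x' = d.emb x) →
      ∀ (v : HeightOneSpectrum (𝓞 K)), (l : 𝓞 K) ∈ v.asIdeal →
      addOrderOf ((galoisCohomology.localization
          ((W.baseChange K).torsionGaloisModule ((p ^ M : ℕ) : ℤ)) (Sum.inr v) 1 :
            galH1Torsion (W.baseChange K) ((p ^ M : ℕ) : ℤ) →+ _)
          (d'.kolyvaginClass (Fact.out : p.Prime) M)) =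
        addOrderOf ((galoisCohomology.localization
          ((W.baseChange K).torsionGaloisModule ((p ^ M : ℕ) : ℤ)) (Sum.inr v) 1 :
            galH1Torsion (W.baseChange K) ((p ^ M : ℕ) : ℤ) →+ _)
          (d.kolyvaginClass (Fact.out : p.Prime) M)))
    (hPT : poitouTate_selmerStructure_duality_conj K)
    {n' : ℤ} (hcop' : IsCoprime (p : ℤ) n')
    (hGZ : ∀ (m : ℕ), Squarefree m →
      (∀ q ∈ m.primeFactors, Zhang2014.IsKolyvaginPrime (W.conductorNorm ℤ) W K p q) →
      ∀ (dm : KolyvaginHeegnerData Dt β ι m)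
      (γ : ringClassField K ι m ≃ₐ[ℚ] ringClassField K ι m), γ ∈ ringClassGal ι m →
      ∀ v : HeightOneSpectrum (𝓞 K), ¬ (W.baseChange K).HasGoodReductionAt v →
        n' • pointsMap (W.baseChange K) (v.adicCompletion K)
            (dm.toGeomPoints (pointGalHom W (ringClassField K ι m) γ dm.y)) ∈
          E0Receptacle (W.baseChange K) v ∧
        ∀ (ℓ : ℕ), ℓ ∈ m.primeFactors → ∀ (dm' : KolyvaginHeegnerData Dt β ι (m / ℓ))
          (hle : ringClassField K ι (m / ℓ) ≤ ringClassField K ι m),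
          n' • pointsMap (W.baseChange K) (v.adicCompletion K)
              (dm.toGeomPoints (pointGalHom W (ringClassField K ι m) γ
                (WeierstrassCurve.Affine.Point.map (W' := W)
                  ((RingClassField.inclusion ι hle).restrictScalars ℚ) dm'.y))) ∈
            E0Receptacle (W.baseChange K) v) :
    ∀ (u : ℕ),
      (∀ (c : ℕ), Squarefree c →
        (∀ q ∈ c.primeFactors, Zhang2014.IsKolyvaginPrime (W.conductorNorm ℤ) W K p q ∧
          1 + u ≤ Zhang2014.kolyvaginIndex W p q) →
        ∀ dc : KolyvaginHeegnerData Dt β ι c,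
        ∃ Q : (W.baseChange (ringClassField K ι c)).toAffine.Point,
          ((p ^ u : ℕ) : ℤ) • Q = dc.derivedPoint) →
      ∀ (n₀ : ℕ), Squarefree n₀ →
        (∀ q ∈ n₀.primeFactors, Zhang2014.IsKolyvaginPrime (W.conductorNorm ℤ) W K p q ∧
          1 + u ≤ Zhang2014.kolyvaginIndex W p q) →
        ∀ d₀ : KolyvaginHeegnerData Dt β ι n₀,
        (¬ ∃ Q : (W.baseChange (ringClassField K ι n₀)).toAffine.Point,
          ((p ^ (u + 1) : ℕ) : ℤ) • Q = d₀.derivedPoint) →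
        ∀ m' : ℕ, ∃ (n : ℕ) (d : KolyvaginHeegnerData Dt β ι n), Squarefree n ∧
          (∀ q ∈ n.primeFactors, Zhang2014.IsKolyvaginPrime (W.conductorNorm ℤ) W K p q ∧
            max m' (1 + u) ≤ Zhang2014.kolyvaginIndex W p q) ∧
          ¬ ∃ Q : (W.baseChange (ringClassField K ι n)).toAffine.Point,
            ((p ^ (u + 1) : ℕ) : ℤ) • Q = d.derivedPoint := by
  intro u hmin n₀ hn₀ hn₀K d₀ hnd₀ m'
  have hp : p.Prime := Fact.out
  have hD : NumberField.discr K < -4 := KolyvaginAssembly.discr_lt_neg_four hK ⟨hD3, hD4⟩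
  have hττ : τ * τ = 1 := Walk.algEquiv_mul_self_eq_one hK τ hτ1
  haveI : NeZero (p ^ 1) := ⟨pow_ne_zero 1 hp.ne_zero⟩
  haveI : Finite (geomTorsion (W.baseChange K) ((p ^ 1 : ℕ) : ℤ)) :=
    finite_geomTorsion_of_neZero (W.baseChange K) (p ^ 1)
  -- the level-`p` Poitou–Tate package (named fact) and the Weil datum (proved)
  obtain ⟨inv, hperf, hvan, -, hSC, hconj⟩ := hPT (p ^ 1)
  have h2 : 2 ≤ p ^ 1 := by rw [pow_one]; exact hp.two_le
  obtain ⟨e, hμ, hadd₁, hadd₂, hgal, halt, hnondeg, hτe⟩ := exists_weilDatum_liftAut W τ (p ^ 1) h2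
  -- the global intrinsic transverse family at level `p`, with its four local inputs
  obtain ⟨𝒯, h𝒯, -⟩ := Walk.exists_globalTransverseFamily W ι ((p ^ 1 : ℕ) : ℤ)
  refine exists_conductor_levelIndex_ge_of_minDepth_of_irreducible W τ p e hμ hadd₁ hadd₂ hgal halt hnondeg hτe hK
    hD3 hD4 hH hcm hp2 hirr hpN hτ1 hττ Dt β ι G hG h47row inv hperf hvan hSC (hconj τ) 𝒯 h𝒯 ?_ ?_ ?_ ?_ hcop' hGZ
    hmin hn₀ hn₀K d₀ hnd₀ m'
  · -- `h𝒯σ`: `τ`-stability at the places of every square-free Kolyvagin conductor (Gross §3 dihedral)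
    intro c hc _ v w h hv x hx
    exact Walk.globalTransverse_conjActPlace_mem h𝒯 τ hc
      (forall_conjActPlace_mem_of_eq_iInf_transverseSubgroup W hK ι τ ((p ^ 1 : ℕ) : ℤ) c) v w h hv x hx
  · -- `h𝒯sd`: self-duality at the places of every square-free Kolyvagin conductor (Lagrangian, `d_K < −4`)
    intro c hc hcK
    exact Walk.globalTransverse_dualTransported_eq (ι := ι) h𝒯 hc
      (fun 𝒯c h𝒯c ↦ RingClassTransverse.dualTransported_eq_of_localTransverseFamily W K hK hD ι p hp2 1 le_rfl
        c hc (fun l hl ↦ hcK l hl) (fun l hl ↦ (hcK l hl).2.2.2.2.2) 𝒯c h𝒯c e hμ hadd₁ hadd₂ hgal halt hnondeg)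
      inv hperf
  · -- `hloc`: the local index `[H¹(K_λ)^s : Kum_λ^s] = p` at a Kolyvagin place
    intro ℓ hℓ hk v hv hfix s hs
    exact GlobalDuality.relIndex_kummer_ker_conjActPlace_eq_pow W K hK hPT hp2 hτ1 hττ le_rfl ℓ hℓ hk v hv hfix s hs
  · -- `hdisj`: `H¹_f ∩ H¹_tr = 0` at a Kolyvagin place ([J] §4.2)
    intro ℓ hℓ v hv
    exact Walk.globalTransverse_disjoint_kummer h𝒯
      (P := fun ℓ ↦ Zhang2014.IsKolyvaginPrime (W.conductorNorm ℤ) W K p ℓ)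
      (fun ℓ hℓ w hw ↦ Walk.disjoint_kummer_iInf_transverseSubgroup W K hK hD ι 1 hℓ w hw)
      (fun ℓ hℓ ↦ hℓ.1) ℓ hℓ v hv

/-- **LEVEL RAISING AT MINIMAL DEPTH ⟸ {`h47P2`, `hPT`, `hGZg`} on every frame of the node with `p ≠ 3`** — pv-2's binder
`hraise` (the only use the §6 bridge makes of McCallum Prop. 5.2) for `E[p]` IRREDUCIBLE, `p ∣ N_E`, `p ∉ {2, 3}` (then no
Zhang–Kolyvagin prime is `2`, which is the guard of `h47P2`; automatic on the K8-t′ face), from THREE NAMED INPUTS: k8t-c4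
g11's primed (B)-only `ℓ ≠ 2` reading `h47P2` of McCallum Prop. 4.4 (⟸ `GrossLMS1991.prop37_2_frobeniusCongruence`, p541604),
Poitou–Tate for the tree's Selmer structures, and k9-c4 g10's guarded image-free receptacle schema `hGZg`
(⟸ `Gross1991_heegnerPoint_sub_ratTorsion_mem_E0_imageFree`). [cite: McCallumLMS1991, §5 Prop. 5.2 and proof (pp. 304–306), §4 Prop. 4.4]
[cite: GrossLMS1991, Prop. 3.7 (2)] [cite: GrossZagier1986, III (3.1)] -/
theorem levelRaising_of_prop47P2_of_poitouTate_of_GZ31g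
    (h47P2 : ∀ (W : WeierstrassCurve ℚ) [W.IsElliptic] [W.IsGloballyMinimal] [NeZero (W.conductorNorm ℤ)],
        ¬ W.HasCM →
        ∀ (K : Type) [Field K] [NumberField K], IsImaginaryQuadratic K →
        NumberField.discr K ≠ -3 → NumberField.discr K ≠ -4 →
        SatisfiesHeegnerHypothesis (W.conductorNorm ℤ) K →
        ∀ (p : ℕ) [Fact p.Prime], p ≠ 2 → W.HasIrreducibleModPGaloisRep p → (p : ℤ) ∣ W.conductorNorm ℤ →
        ∀ (Dt : ModularParametrizationData W (W.conductorNorm ℤ)) (β : ℤ) (ι : K →+* ℂ)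
          (M : ℕ), 1 ≤ M →
        ∀ (m l : ℕ), Squarefree (m * l) → l.Prime → l ≠ 2 → ¬ l ∣ m →
          (∀ l' ∈ (m * l).primeFactors, Zhang2014.IsKolyvaginPrime (W.conductorNorm ℤ) W K p l' ∧
            M ≤ Zhang2014.kolyvaginIndex W p l') →
        ∀ (d : KolyvaginHeegnerData Dt β ι m) (d' : KolyvaginHeegnerData Dt β ι (m * l)),
          (∀ l' ∈ m.primeFactors, ∀ (x : ringClassField K ι m) (x' : ringClassField K ι (m * l)),
            (x : ℂ) = x' → ((d'.σ l' x' : ringClassField K ι (m * l)) : ℂ) = (d.σ l' x : ℂ)) →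
          (∀ s ∈ d.S, ∃ s' ∈ d'.S, ∀ (x : ringClassField K ι m) (x' : ringClassField K ι (m * l)),
            (x : ℂ) = x' → ((s' x' : ringClassField K ι (m * l)) : ℂ) = (s x : ℂ)) →
          (∀ s' ∈ d'.S, ∃ s ∈ d.S, ∀ (x : ringClassField K ι m) (x' : ringClassField K ι (m * l)),
            (x : ℂ) = x' → ((s' x' : ringClassField K ι (m * l)) : ℂ) = (s x : ℂ)) →
          (∀ (x : ringClassField K ι m) (x' : ringClassField K ι (m * l)),
            (x : ℂ) = x' → d'.emb x' = d.emb x) →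
        ∀ (v : HeightOneSpectrum (𝓞 K)), (l : 𝓞 K) ∈ v.asIdeal →
        ∀ (j : ℕ),
          (((p ^ j : ℕ) : ℤ) • d'.kolyvaginClass (Fact.out : p.Prime) M ∈
              (W.baseChange K).torsionLocalKer (v.adicCompletion K) ((p ^ M : ℕ) : ℤ) ↔
            ((p ^ j : ℕ) : ℤ) • d.kolyvaginClass (Fact.out : p.Prime) M ∈
              (W.baseChange K).torsionLocalKer (v.adicCompletion K) ((p ^ M : ℕ) : ℤ)))
    (hPT : ∀ (K : Type) [Field K] [NumberField K], poitouTate_selmerStructure_duality_conj K)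
    (hGZg : ∀ (W : WeierstrassCurve ℚ) [W.IsElliptic] [W.IsGloballyMinimal] [NeZero (W.conductorNorm ℤ)]
      (K : Type) [Field K] [NumberField K], IsImaginaryQuadratic K →
      NumberField.discr K ≠ -3 → NumberField.discr K ≠ -4 →
      SatisfiesHeegnerHypothesis (W.conductorNorm ℤ) K →
      ∀ (p : ℕ) [Fact p.Prime], p ≠ 2 → W.HasIrreducibleModPGaloisRep p →
      ∀ (Dt : ModularParametrizationData W (W.conductorNorm ℤ)) (β : ℤ) (ι : K →+* ℂ)
      [∀ j : ℕ, NumberField (ringClassField K ι j)],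
      ∃ n' : ℤ, IsCoprime (p : ℤ) n' ∧ ∀ (m : ℕ), Squarefree m →
        (∀ q ∈ m.primeFactors, Zhang2014.IsKolyvaginPrime (W.conductorNorm ℤ) W K p q) →
        ∀ (dm : KolyvaginHeegnerData Dt β ι m)
        (γ : ringClassField K ι m ≃ₐ[ℚ] ringClassField K ι m), γ ∈ ringClassGal ι m →
        ∀ v : HeightOneSpectrum (𝓞 K), ¬ (W.baseChange K).HasGoodReductionAt v →
          n' • pointsMap (W.baseChange K) (v.adicCompletion K)
              (dm.toGeomPoints (pointGalHom W (ringClassField K ι m) γ dm.y)) ∈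
            E0Receptacle (W.baseChange K) v ∧
          ∀ (ℓ : ℕ), ℓ ∈ m.primeFactors → ∀ (dm' : KolyvaginHeegnerData Dt β ι (m / ℓ))
            (hle : ringClassField K ι (m / ℓ) ≤ ringClassField K ι m),
            n' • pointsMap (W.baseChange K) (v.adicCompletion K)
                (dm.toGeomPoints (pointGalHom W (ringClassField K ι m) γ
                  (WeierstrassCurve.Affine.Point.map (W' := W)
                    ((RingClassField.inclusion ι hle).restrictScalars ℚ) dm'.y))) ∈
              E0Receptacle (W.baseChange K) v) :
    ∀ (W : WeierstrassCurve ℚ) [W.IsElliptic] [W.IsGloballyMinimal] [NeZero (W.conductorNorm ℤ)],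
      ¬ W.HasCM →
      ∀ (K : Type) [Field K] [NumberField K], IsImaginaryQuadratic K →
      NumberField.discr K ≠ -3 → NumberField.discr K ≠ -4 →
      SatisfiesHeegnerHypothesis (W.conductorNorm ℤ) K →
      ∀ (τ : K ≃ₐ[ℚ] K), τ ≠ 1 →
      ∀ (p : ℕ) [Fact p.Prime], p ≠ 2 → p ≠ 3 → W.HasIrreducibleModPGaloisRep p → p ∣ W.conductorNorm ℤ →
      ∀ (Dt : ModularParametrizationData W (W.conductorNorm ℤ)) (β : ℤ) (ι : K →+* ℂ)
        [∀ j : ℕ, NumberField (ringClassField K ι j)],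
      ∀ (u : ℕ),
        (∀ (c : ℕ), Squarefree c →
          (∀ q ∈ c.primeFactors, Zhang2014.IsKolyvaginPrime (W.conductorNorm ℤ) W K p q ∧
            1 + u ≤ Zhang2014.kolyvaginIndex W p q) →
          ∀ dc : KolyvaginHeegnerData Dt β ι c,
          ∃ Q : (W.baseChange (ringClassField K ι c)).toAffine.Point,
            ((p ^ u : ℕ) : ℤ) • Q = dc.derivedPoint) →
        ∀ (n₀ : ℕ), Squarefree n₀ →
          (∀ q ∈ n₀.primeFactors, Zhang2014.IsKolyvaginPrime (W.conductorNorm ℤ) W K p q ∧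
            1 + u ≤ Zhang2014.kolyvaginIndex W p q) →
          ∀ d₀ : KolyvaginHeegnerData Dt β ι n₀,
          (¬ ∃ Q : (W.baseChange (ringClassField K ι n₀)).toAffine.Point,
            ((p ^ (u + 1) : ℕ) : ℤ) • Q = d₀.derivedPoint) →
          ∀ m' : ℕ, ∃ (n : ℕ) (d : KolyvaginHeegnerData Dt β ι n), Squarefree n ∧
            (∀ q ∈ n.primeFactors, Zhang2014.IsKolyvaginPrime (W.conductorNorm ℤ) W K p q ∧
              max m' (1 + u) ≤ Zhang2014.kolyvaginIndex W p q) ∧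
            ¬ ∃ Q : (W.baseChange (ringClassField K ι n)).toAffine.Point,
              ((p ^ (u + 1) : ℕ) : ℤ) • Q = d.derivedPoint := by
  intro W _ _ _ hcm K _ _ hK hD3 hD4 hH τ hτ1 p _ hp2 hp3 hirr hpN Dt β ι _
  have hp : p.Prime := Fact.out
  -- [GZ86 III (3.1)] at this frame (guarded scoped schema)
  obtain ⟨n', hcop', hGZ'⟩ := hGZg W K hK hD3 hD4 hH p hp2 hirr Dt β ι
  -- the guard `ℓ ≠ 2` of `h47P2` holds at every Zhang–Kolyvagin prime since `p ≠ 3`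
  have hG : ∀ ℓ : ℕ, Zhang2014.IsKolyvaginPrime (W.conductorNorm ℤ) W K p ℓ → ℓ ≠ 2 := by
    rintro ℓ hℓ rfl
    have h3 : p ∣ 3 := by simpa using hℓ.dvd.1
    exact hp3 ((Nat.prime_dvd_prime_iff_eq hp Nat.prime_three).mp h3)
  exact levelRaising_of_h47row_of_poitouTate_of_GZ31_of_irreducible W hK hD3 hD4 hH hcm τ hτ1 p hp2 hirr hpN Dt β ι
    (fun ℓ ↦ ℓ ≠ 2) hG
    (fun M hM m l hml hl hl2 hlm hK' d d' hσ hS hS' hemb v hv ↦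
      JetchevIrreducibleH63P2.addOrderOf_localization_kolyvaginClass_mul_eq_of_prop47IrredP2 h47P2 W hcm K hK hD3
        hD4 hH p hp2 hirr hpN Dt β ι M hM m l hml hl hl2 hlm hK' d d' hσ hS hS' hemb v hv)
    (hPT K) hcop' hGZ'

end Summit.BirchSwinnertonDyer.BirchSwinnertonDyer.Theorems.JetchevIrreducibleSwap

end
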